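import Summits.CriticalPhenomena.PercolationContinuityZ3.Theorems.Transplant.FKConnectivityAllQPat3KNetDefs
import HarnessLib

/-!
# Connectivity correlation inequalities for `φ_{w,q}`, every `q > 0` — re-rooting bridge–series–parallel networks

Helper file (`--supports stmt-CriticalPhenomena-4575`), census lineage (gen 41) of LANE 2's FK sub-programme; builds on p205010 (kernel
theorem, internal audit signed; external expert review pending).  No definitions, no named facts, no sorries; standard axioms.

Census g37's «Pat3SPRecursion» re-roots a two-terminal series–parallel network inside a parallel composition (`FK.reroot_serA / serB /
par / par'`, `FK.junction_not_mem`, `FK.card_left/right_lt_of_parallel`) — the structural steps of THEOREM SP's inner recursion.  This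
file states the same lemmas for the class 𝒦 of bridge–series–parallel networks (`FK.IsKNet`, census g41 «Pat3KNetDefs»): the
constructors `IsKNet.series / parallel` have the side conditions of `IsTTSP.series / parallel`, so the proofs are census g37's, renamed.
(Port map: census g41 memo §6 (b).)
[cite: AyyerLinussonRavichandran2025, §7 (p. 22)]
-/

namespace Summit.CriticalPhenomena.PercolationContinuityZ3.Theorems

namespace FK

open scoped Classical

variable {V : Type*}

section RerootK

variable {F₁ F₂ E₂ : Finset (Sym2 V)} {x m y : V}

/-- In a parallel composition with a 𝒦-network the first part is smaller than the whole. [folklore] -/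
theorem card_left_lt_of_parallelK {Q₁ Q₂ : Finset (Sym2 V)} {s t : V} (h₂ : IsKNet Q₂ s t) (hd : Disjoint Q₁ Q₂) :
    Q₁.card < (Q₁ ∪ Q₂).card := by
  rw [Finset.card_union_of_disjoint hd]
  have := h₂.card_pos
  omega

/-- In a parallel composition with a 𝒦-network the second part is smaller than the whole. [folklore] -/
theorem card_right_lt_of_parallelK {Q₁ Q₂ : Finset (Sym2 V)} {s t : V} (h₁ : IsKNet Q₁ s t) (hd : Disjoint Q₁ Q₂) :
    Q₂.card < (Q₁ ∪ Q₂).card := by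
  rw [Finset.card_union_of_disjoint hd]
  have := h₁.card_pos
  omega

/-- The junction of a series composition of 𝒦-networks inside a parallel composition is off the other parallel part. [folklore] -/
theorem junction_not_memK (hV : ∀ z : V, (∃ e ∈ F₁ ∪ F₂, z ∈ e) → (∃ e ∈ E₂, z ∈ e) → z = x ∨ z = y)
    (hF₁ : IsKNet F₁ x m) (hF₂ : IsKNet F₂ m y) : ∀ e ∈ E₂, m ∉ e := by
  intro e he hme
  obtain ⟨f, hf, hmf⟩ := hF₁.right_mem
  rcases hV m ⟨f, Finset.mem_union_left _ hf, hmf⟩ ⟨e, he, hme⟩ with h | h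
  · exact hF₁.ne h.symm
  · exact hF₂.ne h

/-- **Re-rooting A in 𝒦:** `(F₁ ·ₘ F₂) ∥ E₂` between `x, y` is also `F₁ ∥ (F₂ · E₂ᵀ)` between `m` and `x`; the series composition
`F₂(m, y) · E₂(y, x)` is a 𝒦-network between `m` and `x`, edge-disjoint from `F₁` and meeting it inside `{m, x}`. [folklore] -/
theorem rerootK_serA (h₂ : IsKNet E₂ x y) (hd : Disjoint (F₁ ∪ F₂) E₂)
    (hV : ∀ z : V, (∃ e ∈ F₁ ∪ F₂, z ∈ e) → (∃ e ∈ E₂, z ∈ e) → z = x ∨ z = y)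
    (hF₁ : IsKNet F₁ x m) (hF₂ : IsKNet F₂ m y) (hdF : Disjoint F₁ F₂)
    (hVF : ∀ z : V, (∃ e ∈ F₁, z ∈ e) → (∃ e ∈ F₂, z ∈ e) → z = m) (hxF₂ : ∀ e ∈ F₂, x ∉ e) (hyF₁ : ∀ e ∈ F₁, y ∉ e) :
    IsKNet (F₂ ∪ E₂) m x ∧ Disjoint F₁ (F₂ ∪ E₂) ∧
      (∀ z : V, (∃ e ∈ F₁, z ∈ e) → (∃ e ∈ F₂ ∪ E₂, z ∈ e) → z = m ∨ z = x) := by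
  have hd1 : Disjoint F₁ E₂ := (Finset.disjoint_union_left.1 hd).1
  have hd2 : Disjoint F₂ E₂ := (Finset.disjoint_union_left.1 hd).2
  refine ⟨IsKNet.series hF₂ h₂.symm hd2 (fun z hz2 hzE => ?_) (junction_not_memK hV hF₁ hF₂) hxF₂,
    Finset.disjoint_union_right.2 ⟨hdF, hd1⟩, fun z hz1 hz => ?_⟩
  · obtain ⟨e, he, hze⟩ := hz2
    rcases hV z ⟨e, Finset.mem_union_right _ he, hze⟩ hzE with h | h
    · exact absurd hze (h ▸ hxF₂ e he)
    · exact h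
  · obtain ⟨e, he, hze⟩ := hz
    rcases Finset.mem_union.1 he with he | he
    · exact Or.inl (hVF z hz1 ⟨e, he, hze⟩)
    · obtain ⟨f, hf, hzf⟩ := hz1
      rcases hV z ⟨f, Finset.mem_union_left _ hf, hzf⟩ ⟨e, he, hze⟩ with h | h
      · exact Or.inr h
      · exact absurd hzf (h ▸ hyF₁ f hf)

/-- **Re-rooting B in 𝒦:** `(F₁ ·ₘ F₂) ∥ E₂` between `x, y` is also `F₂ ∥ (F₁ᵀ · E₂)` between `m` and `y`. [folklore] -/
theorem rerootK_serB (h₂ : IsKNet E₂ x y) (hd : Disjoint (F₁ ∪ F₂) E₂)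
    (hV : ∀ z : V, (∃ e ∈ F₁ ∪ F₂, z ∈ e) → (∃ e ∈ E₂, z ∈ e) → z = x ∨ z = y)
    (hF₁ : IsKNet F₁ x m) (hF₂ : IsKNet F₂ m y) (hdF : Disjoint F₁ F₂)
    (hVF : ∀ z : V, (∃ e ∈ F₁, z ∈ e) → (∃ e ∈ F₂, z ∈ e) → z = m) (hxF₂ : ∀ e ∈ F₂, x ∉ e) (hyF₁ : ∀ e ∈ F₁, y ∉ e) :
    IsKNet (F₁ ∪ E₂) m y ∧ Disjoint F₂ (F₁ ∪ E₂) ∧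
      (∀ z : V, (∃ e ∈ F₂, z ∈ e) → (∃ e ∈ F₁ ∪ E₂, z ∈ e) → z = m ∨ z = y) := by
  have hd1 : Disjoint F₁ E₂ := (Finset.disjoint_union_left.1 hd).1
  have hd2 : Disjoint F₂ E₂ := (Finset.disjoint_union_left.1 hd).2
  refine ⟨IsKNet.series hF₁.symm h₂ hd1 (fun z hz1 hzE => ?_) (junction_not_memK hV hF₁ hF₂) hyF₁,
    Finset.disjoint_union_right.2 ⟨hdF.symm, hd2⟩, fun z hz2 hz => ?_⟩
  · obtain ⟨e, he, hze⟩ := hz1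
    rcases hV z ⟨e, Finset.mem_union_left _ he, hze⟩ hzE with h | h
    · exact h
    · exact absurd hze (h ▸ hyF₁ e he)
  · obtain ⟨e, he, hze⟩ := hz
    rcases Finset.mem_union.1 he with he | he
    · exact Or.inl (hVF z ⟨e, he, hze⟩ hz2)
    · obtain ⟨f, hf, hzf⟩ := hz2
      rcases hV z ⟨f, Finset.mem_union_right _ hf, hzf⟩ ⟨e, he, hze⟩ with h | h
      · exact absurd hzf (h ▸ hxF₂ f hf)
      · exact Or.inr h

/-- **Re-associating a parallel composition in 𝒦:** `(Q₁ ∥ Q₂) ∥ E₂` is `Q₁ ∥ (Q₂ ∥ E₂)`. [folklore] -/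
theorem rerootK_par {Q₁ Q₂ E₂ : Finset (Sym2 V)} {x y : V} (h₂ : IsKNet E₂ x y) (hd : Disjoint (Q₁ ∪ Q₂) E₂)
    (hV : ∀ z : V, (∃ e ∈ Q₁ ∪ Q₂, z ∈ e) → (∃ e ∈ E₂, z ∈ e) → z = x ∨ z = y)
    (hQ₂ : IsKNet Q₂ x y) (hdQ : Disjoint Q₁ Q₂)
    (hVQ : ∀ z : V, (∃ e ∈ Q₁, z ∈ e) → (∃ e ∈ Q₂, z ∈ e) → z = x ∨ z = y) :
    IsKNet (Q₂ ∪ E₂) x y ∧ Disjoint Q₁ (Q₂ ∪ E₂) ∧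
      (∀ z : V, (∃ e ∈ Q₁, z ∈ e) → (∃ e ∈ Q₂ ∪ E₂, z ∈ e) → z = x ∨ z = y) := by
  have hd1 : Disjoint Q₁ E₂ := (Finset.disjoint_union_left.1 hd).1
  have hd2 : Disjoint Q₂ E₂ := (Finset.disjoint_union_left.1 hd).2
  refine ⟨IsKNet.parallel hQ₂ h₂ hd2 fun z hz2 hzE => ?_, Finset.disjoint_union_right.2 ⟨hdQ, hd1⟩, fun z hz1 hz => ?_⟩
  · obtain ⟨e, he, hze⟩ := hz2
    exact hV z ⟨e, Finset.mem_union_right _ he, hze⟩ hzE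
  · obtain ⟨e, he, hze⟩ := hz
    rcases Finset.mem_union.1 he with he | he
    · exact hVQ z hz1 ⟨e, he, hze⟩
    · obtain ⟨f, hf, hzf⟩ := hz1
      exact hV z ⟨f, Finset.mem_union_left _ hf, hzf⟩ ⟨e, he, hze⟩

/-- The same re-association with the roles of `Q₁`, `Q₂` exchanged: `Q₂ ∥ (Q₁ ∥ E₂)`. [folklore] -/
theorem rerootK_par' {Q₁ Q₂ E₂ : Finset (Sym2 V)} {x y : V} (h₂ : IsKNet E₂ x y) (hd : Disjoint (Q₁ ∪ Q₂) E₂)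
    (hV : ∀ z : V, (∃ e ∈ Q₁ ∪ Q₂, z ∈ e) → (∃ e ∈ E₂, z ∈ e) → z = x ∨ z = y)
    (hQ₁ : IsKNet Q₁ x y) (hdQ : Disjoint Q₁ Q₂)
    (hVQ : ∀ z : V, (∃ e ∈ Q₁, z ∈ e) → (∃ e ∈ Q₂, z ∈ e) → z = x ∨ z = y) :
    IsKNet (Q₁ ∪ E₂) x y ∧ Disjoint Q₂ (Q₁ ∪ E₂) ∧
      (∀ z : V, (∃ e ∈ Q₂, z ∈ e) → (∃ e ∈ Q₁ ∪ E₂, z ∈ e) → z = x ∨ z = y) := by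
  rw [Finset.union_comm] at hd hV
  exact rerootK_par h₂ hd hV hQ₁ hdQ.symm fun z hz2 hz1 => hVQ z hz1 hz2

/-- **Re-rooting a parallel composition at a BRIDGE side's slot (𝒦 only)**: `E = B ∥ E₂` with `B` the bridge on poles `x = a`,
`y = b`; the rest of `E` seen from the slot `Q_cd` — `E ∖ Q_cd = (Q_ac ∪ Q_ad ∪ Q_bc ∪ Q_bd) ∪ E₂` — contains the parallel part
`E₂` whole, so for the inner recursion on the side being decomposed the measure `|side|` drops from `|B|` to `|Q_cd|`. [folklore] -/
theorem card_slot_lt_bridge {Qac Qad Qbc Qbd Qcd : Finset (Sym2 V)} {a d : V} (had : IsKNet Qad a d) (hsep_d : Disjoint Qad Qcd) :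
    Qcd.card < (Qac ∪ Qad ∪ Qbc ∪ Qbd ∪ Qcd).card := by
  have h1 : Qad ∪ Qcd ⊆ Qac ∪ Qad ∪ Qbc ∪ Qbd ∪ Qcd := by
    intro e he
    rcases Finset.mem_union.1 he with h | h
    · exact Finset.mem_union_left _ (Finset.mem_union_left _ (Finset.mem_union_left _ (Finset.mem_union_right _ h)))
    · exact Finset.mem_union_right _ h
  have h2 := Finset.card_le_card h1
  rw [Finset.card_union_of_disjoint hsep_d] at h2
  have := had.card_pos
  omega

end RerootK

end FK

end Summit.CriticalPhenomena.PercolationContinuityZ3.Theorems
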